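import Literature.MathematicalPhysics.QuantumFieldTheory.Balaban1983to89.Node00.FibreIntegralMovingThreshold
import Summits.QuantumFields.YangMills.Theorems.BalabanUVNodesN09TransportPositiveOnDomainOfFibredChart

/-!
# NODE N09 · THE (F1) INDUCTION STEP `k → k+1` IN CLOSED FORM: `A_k` continuous on `domAlt_k` + A-FREE regularity of the step-`k` fibred chart ⇒ the fibre
# integral of the (0.19) density `ρ_k` is continuous on `domAlt_{k+1}` (`hgc_k`) ⇒ `hreg_k` ∧ (F3)_k ⇒ `A_{k+1}` continuous on `domAlt_{k+1}`; and the base `A_0`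

Cell `pub-ymgap` (YM-PLAN Track A), DAG node N09 [Balaban1987RG1] (= [I]); seat `pub-ymgap-dag-n09-w1` g5 (D-0149 width seat 1 of node N09), FILE 2; count-neutral helper
keyed to K1⁷ `StabilityBAtRecordR13SepCoPH` = stmt-QuantumFields-20542 (`--kind proof --supports … --as helper`).  HONEST FRAMING: kernel topology ∕ measure theory at NODE 00's
definitions BY NAME over dag-n09-w6 g2's engine; NOTHING of Bałaban's analysis asserted; every chart datum DISPLAYED ((M3r) — the (2.10) chart at the record — stays UNOWNED);
N09 NOT discharged; K0⁷∕K1⁷ NOT closed; counts unmoved (typed 28∕28 · discharged 5∕27); one finite 𝕋⁴ programme at fixed ε — R4 closes the conditional rung `BalabanLadder.UV`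
only; the Yang–Mills mass gap (Clay) is NOT proved by any of this; nothing continuum ∕ ℝ⁴ ∕ OS.

WHY.  N09's analytic binder `hreg : ∀ j < K, domAlt_{j+1} ⊆ regSetOfRecord K j ρ_j` ([I] p. 259; K0e's located debt (F1)) is re-shaped by dag-n09-w6 g2's fibred-chart doors
(`Node00.RegSetOfFibredChart`, `…N09HregOfFibredChartAtRecord`) into per-step chart data `(Z, τ, Φ, J, S; hΦ hJ havgΦ hmap)` PLUS `hgc_j` — continuity on `domAlt_{j+1}` of the
fibre integral `V ↦ ∫ J(V,z)·ρ_j(Φ(V,z)) dτ(z)` — and their supplier of `hgc_j` (`Node00.continuousOn_fibreIntegral_betaInput_chiFixed29_of_thresholdNull`, p612459) displays the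
continuity of the smooth factor `J·exp[−GF_j∕g_j² + A_j]∘Φ` with the effective action `A_j` INSIDE the hypothesis and ONE global `τ`-bound.  But `A_j = log 𝐍_{j−1}⁻¹ T_{j−1}ρ_{j−1}`
is the (0.19) recursion itself: its continuity on `domAlt_j` is exactly what the PREVIOUS step proved (FILE 1 `…N09TransportPositiveOnDomainOfFibredChart` §4: `hreg_{j−1}` + (F3)_{j−1}
⇒ `A_j` continuous on `domAlt_j`).  THIS FILE separates the recursion from the chart: `hgc_k` follows from A-FREE regularity of the step-`k` chart — a.e.-`z` continuity in the coarse
field of `Φ` and `J`, fibre-nullity of the exact thresholds (w6's `hnull`), a.e. continuity of the (2.9) deviations (w6's `hφ`; N07 ∕ selector content), a LOCAL integrable bound on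
`J` with COMPACT CONFINEMENT `Φ(V,z) ∈ C ⊆ domAlt_k` for `V` near `V₀` (print: the (2.10) box maps into the CURRENT small-field domain by the threshold hierarchy, with margin),
continuity of the gauge-fixing term `GF_k` on `domAlt_k` (DISPLAYED — Federbush-contour continuity on the small-field domain is not a tree theorem) — plus the SINGLE recursive
input `ContinuousOn A_k domAlt_k`.  Then THE STEP `k → k+1` and THE BASE `A_0 = −A∕g_0²` are theorems, so the (F1) tower over `k` is an honest induction whose per-step data
no longer mention `A`.

WHAT IS PROVED (theorems only; 0 def; 0 sorry; axioms standard).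
* §1 GENERIC: `continuousWithinAt_smoothFactor_comp` (the smooth factor `J·exp[c·GF∘Φ + A∘Φ]` is continuous at `x₀` within `U` when `Φ(x₀) ∈ D` open and `GF`, `A` are
  continuous on `D`), `exists_forall_le_of_isCompact` (a continuous function on a compact set is bounded above — the `max_C A_k` of the domination).
* §2 AT THE β-INPUT `ρ_k = betaInputOfRecord T (chiFixed29 ν ε₁) K g k` (ANY transport `T`): `norm_jacobian_mul_betaInput_chi29_le` (`‖J·ρ_k(Φ)‖ ≤ bound·e^{M}` under confinement),
  `integrable_fibreIntegrand_betaInput_chi29_of_confined` (per-`V` integrability `hintV` from the local bound), ★★★ `continuousOn_fibreIntegral_betaInput_chi29_of_chartRegularity`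
  (`hgc_k` ⇐ A-free chart regularity + `ContinuousOn A_k D` + `ContinuousOn GF_k D`, `D` open ⊇ the confinement sets; w6's pointwise dominated convergence + moving thresholds).
* §3 THE STEP at `T = TcanOfRecord` (= `TβOfRecord₁₃`), `D = domAltOfRecord ν K k`, `U = domAltOfRecord ν K (k+1)`: ★★★ `hreg_pos_contA_of_chartRegularity` — from `ContinuousOn A_k domAlt_k`,
  the step-`k` chart through the critical configuration and its A-free regularity: `hreg_k` (w6's `domAlt_subset_regSetOfRecord_of_fibredChart`) ∧ (F3)_k (FILE 1) ∧
  `ContinuousOn A_{k+1} domAlt_{k+1}` (FILE 1 §4); ★★ `continuousOn_effActionHT_succ_of_chartRegularity` (the third conjunct alone: THE INDUCTION STEP).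
* §4 THE BASE: `continuous_wilsonAction_SU`, ★ `continuous_effActionHT_zero` (`A_0 = −(1∕g_0²)A` is continuous everywhere), `continuousOn_effActionHT_zero`.

HONEST SCOPE.  (i) Every chart datum is DISPLAYED; the file proves bookkeeping implications only.  (ii) The deviations' a.e. continuity `hφ` reads the bare-choice background `Uk`
through `critCfgOfRecord` — at the record it is N07's [B11] Thm 1 + the selector re-point (dag-n09-w2∕w4), displayed.  (iii) `GF_k` continuous on `domAlt_k` is displayed.
(iv) `hmeas` (a.e.-strong measurability of the fibre integrand near each `V₀`) is displayed (it mentions `ρ_k`; a measurability triviality once (H-U) is settled).  (v) `k < K`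
where `HaarAC` of record is used; `0 < ε₁` for the base point.  (vi) Nothing of w6 ∕ K0e ∕ FILE 1 re-proved — consumed BY NAME.
-/

noncomputable section

open MeasureTheory Set Filter Topology
open scoped ENNReal NNReal
open Literature.MathematicalPhysics.QuantumFieldTheory
open Literature.MathematicalPhysics.QuantumFieldTheory.Balaban1983to89
open Literature.MathematicalPhysics.QuantumFieldTheory.Balaban1983to89.Node00
open Literature.MathematicalPhysics.QuantumFieldTheory.Balaban1983to89.T4Continuum (T4Family)
open Literature.MathematicalPhysics.QuantumFieldTheory.Balaban1983to89.B12Eq019ActionBody (integrand integrand_apply wilsonTerm wilsonTerm_apply)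
open Literature.MathematicalPhysics.QuantumFieldTheory.Balaban1983to89.B12ContinuousTransportInvarianceOn (isOpen_domAltOfRecord continuous_dist1_SU continuous_plaqHol_SU)
open Literature.MathematicalPhysics.QuantumFieldTheory.Balaban1983to89.B12NodeKnitContinuousTransport (gfOfRecord_nonneg)
open Summit.QuantumFields.YangMills.BalabanUVNodes.N09TransportPositiveOnDomainOfFibredChart

namespace Summit.QuantumFields.YangMills.BalabanUVNodes.N09FibreIntegralContinuousOfChartRegularity

/-! ## §1 Generic: the smooth factor along a chart; a continuous function is bounded above on a compact set -/

section Generic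

variable {X Y : Type*} [TopologicalSpace X] [TopologicalSpace Y]

/-- **THE SMOOTH FACTOR ALONG A CHART IS CONTINUOUS IN THE COARSE VARIABLE**: if `Φ(·)` is continuous at `x₀` within `U` with `Φ x₀ ∈ D`, `D` open, `J` continuous at `x₀`
within `U`, and `GF`, `A` continuous on `D`, then `x ↦ J x · exp(c·GF(Φ x) + A(Φ x))` is continuous at `x₀` within `U`. [cite: Balaban1987RG1, (2.10) p.267 (bookkeeping)] -/
theorem continuousWithinAt_smoothFactor_comp {U : Set X} {x₀ : X} {D : Set Y} (hD : IsOpen D) {Φ : X → Y} (hΦ : ContinuousWithinAt Φ U x₀)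
    (hx₀ : Φ x₀ ∈ D) {J : X → ℝ} (hJ : ContinuousWithinAt J U x₀) {GF A : Y → ℝ} (hGF : ContinuousOn GF D) (hA : ContinuousOn A D) (c : ℝ) :
    ContinuousWithinAt (fun x => J x * Real.exp (c * GF (Φ x) + A (Φ x))) U x₀ := by
  have hGF' : ContinuousWithinAt (fun x => GF (Φ x)) U x₀ := (hGF.continuousAt (hD.mem_nhds hx₀)).comp_continuousWithinAt hΦ
  have hA' : ContinuousWithinAt (fun x => A (Φ x)) U x₀ := (hA.continuousAt (hD.mem_nhds hx₀)).comp_continuousWithinAt hΦ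
  exact hJ.mul (Real.continuous_exp.continuousAt.comp_continuousWithinAt ((hGF'.const_smul c).add hA'))

/-- A function continuous on a compact set is bounded above on it (empty set: any bound). [cite: Balaban1987RG1, (2.10) p.267 (bookkeeping)] -/
theorem exists_forall_le_of_isCompact {C : Set Y} (hC : IsCompact C) {f : Y → ℝ} (hf : ContinuousOn f C) : ∃ M : ℝ, ∀ y ∈ C, f y ≤ M := by
  rcases C.eq_empty_or_nonempty with hCe | hCne
  · exact ⟨0, fun y hy => by simp [hCe] at hy⟩
  · obtain ⟨y₀, _, hmax⟩ := hC.exists_isMaxOn hCne hf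
    exact ⟨f y₀, fun y hy => hmax hy⟩

end Generic

/-! ## §2 `hgc_k` from A-free chart regularity + `A_k` (and `GF_k`) continuous on an open set confining the chart -/

section Hgc

variable {F : T4Family} {N : ℕ} [NeZero N]

/-- **THE DOMINATION**: with `J(V,z) ≤ bound z`, `Φ(V,z) ∈ C` and `A_k ≤ M` on `C`, the fibre integrand obeys `‖J(V,z)·ρ_k(Φ(V,z))‖ ≤ bound z · e^{M}`
(`0 ≤ χ^{(2.9)} ≤ 1`, `GF_k ≥ 0`, `J ≥ 0`). [cite: Balaban1987RG1, (0.19) p.255 and (2.10) p.267 (bookkeeping)] -/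
theorem norm_jacobian_mul_betaInput_chi29_le (ν : Stage7Numerics) (ε₁ : ℝ) (T : Transport F N) (K : ℕ) (g : ℕ → ℝ) (k : ℕ)
    {C : Set (GaugeField (F.P K) k (SU N))} {M : ℝ} (hM : ∀ U ∈ C, effActionHT F N T (chiFixed29 F N ν ε₁) K g k U ≤ M)
    {J : ℝ≥0} {bound : ℝ} (hJ : (J : ℝ) ≤ bound) {U : GaugeField (F.P K) k (SU N)} (hU : U ∈ C) :
    ‖(J : ℝ) * betaInputOfRecord F N T (chiFixed29 F N ν ε₁) K g k U‖ ≤ bound * Real.exp M := by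
  rw [Real.norm_eq_abs, abs_of_nonneg (mul_nonneg J.coe_nonneg (betaInput_chi29_nonneg ν ε₁ T K g k U)), betaInput_chi29_apply]
  have hχ := chiFix29OfRecord_mem_Icc (F := F) (N := N) ν ε₁ K k U
  have hexp : Real.exp (-(1 / (g k) ^ 2) * gfOfRecord F N K k U + effActionHT F N T (chiFixed29 F N ν ε₁) K g k U) ≤ Real.exp M := by
    refine Real.exp_le_exp.2 ?_
    have h1 : 0 ≤ 1 / (g k) ^ 2 * gfOfRecord F N K k U := mul_nonneg (one_div_nonneg.2 (sq_nonneg _)) (gfOfRecord_nonneg K k U)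
    have h2 := hM U hU
    linarith
  have hb : 0 ≤ bound := J.coe_nonneg.trans hJ
  calc (J : ℝ) * (chiFix29OfRecord F N ν ε₁ K k U *
          Real.exp (-(1 / (g k) ^ 2) * gfOfRecord F N K k U + effActionHT F N T (chiFixed29 F N ν ε₁) K g k U))
      ≤ (J : ℝ) * (1 * Real.exp M) :=
        mul_le_mul_of_nonneg_left (mul_le_mul hχ.2 hexp (Real.exp_pos _).le zero_le_one) J.coe_nonneg
    _ ≤ bound * Real.exp M := by
        rw [one_mul]; exact mul_le_mul_of_nonneg_right hJ (Real.exp_pos _).le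

variable {Z : Type*} [MeasurableSpace Z]

/-- **PER-`V` INTEGRABILITY OF THE FIBRE INTEGRAND FROM THE LOCAL BOUND** (the `hintV` of FILE 1's doors): a.e.-strong measurability at `V`, `J(V,·) ≤ bound` integrable and
confinement `Φ(V,·) ∈ C` a.e. with `A_k ≤ M` on `C`. [cite: Balaban1987RG1, (2.10) p.267 (bookkeeping)] -/
theorem integrable_fibreIntegrand_betaInput_chi29_of_confined (ν : Stage7Numerics) (ε₁ : ℝ) (T : Transport F N) (K : ℕ) (g : ℕ → ℝ) (k : ℕ)
    {τ : Measure Z} {Φ : (PBond (F.P K) (k + 1) → SU N) × Z → GaugeField (F.P K) k (SU N)} {J : (PBond (F.P K) (k + 1) → SU N) × Z → ℝ≥0}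
    {V : PBond (F.P K) (k + 1) → SU N}
    (hmeas : AEStronglyMeasurable (fun z => (J (V, z) : ℝ) * betaInputOfRecord F N T (chiFixed29 F N ν ε₁) K g k (Φ (V, z))) τ)
    {C : Set (GaugeField (F.P K) k (SU N))} {M : ℝ} (hM : ∀ U ∈ C, effActionHT F N T (chiFixed29 F N ν ε₁) K g k U ≤ M)
    {bound : Z → ℝ} (hbi : Integrable bound τ) (hb : ∀ᵐ z ∂τ, (J (V, z) : ℝ) ≤ bound z ∧ Φ (V, z) ∈ C) :
    Integrable (fun z => (J (V, z) : ℝ) * betaInputOfRecord F N T (chiFixed29 F N ν ε₁) K g k (Φ (V, z))) τ := by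
  refine Integrable.mono' (hbi.mul_const (Real.exp M)) hmeas ?_
  filter_upwards [hb] with z hz
  exact norm_jacobian_mul_betaInput_chi29_le ν ε₁ T K g k hM hz.1 hz.2

/-- **★★★ `hgc_k` FROM A-FREE CHART REGULARITY + `A_k` CONTINUOUS ON A CONFINING OPEN SET.**  Let `T` be any transport, `ρ_k = χ^{(2.9)}_k·exp[−GF_k∕g_k² + A_k]` its
step-`k` β-input (`chiFixed29 ν ε₁`), `Φ`, `J`, `τ` chart data over a set `U` of coarse fields, and `D` an OPEN set of step-`k` fields on which `GF_k` and `A_k` are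
continuous.  Suppose, AT EACH `V₀ ∈ U`: the fibre integrand is a.e.-strongly measurable for `V` near `V₀` within `U` (`hmeas`); there are a compact `C ⊆ D` and a
`τ`-integrable `bound` with `J(V,z) ≤ bound z` and `Φ(V,z) ∈ C` for a.e. `z`, for all `V` near `V₀` within `U` (`hconf` — local domination + compact confinement); for a.e. `z`
the maps `V ↦ Φ(V,z)` and `V ↦ J(V,z)` are continuous at `V₀` within `U` (`hΦV`, `hJV`); for every non-distinguished bond `b` the deviation `V ↦ fluctDev_k(Φ(V,z))(b)` is
continuous at `V₀` within `U` for a.e. `z` (`hφ`) and the exact-threshold set `{z | fluctDev_k(Φ(V₀,z))(b) = ε₁}` is `τ`-null (`hnull`).  THEN the fibre integral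
`V ↦ ∫ J(V,z)·ρ_k(Φ(V,z)) dτ(z)` is CONTINUOUS ON `U` — dag-n09-w6 g2's `hgc` with the recursion (`A_k`) separated from the chart (everything else A-free).
[cite: Balaban1987RG1, (2.9) p.266, (2.10) p.267, (0.19) p.255 and p.259] -/
theorem continuousOn_fibreIntegral_betaInput_chi29_of_chartRegularity (ν : Stage7Numerics) (ε₁ : ℝ) (T : Transport F N) (K : ℕ) (g : ℕ → ℝ) (k : ℕ)
    (τ : Measure Z) (Φ : (PBond (F.P K) (k + 1) → SU N) × Z → GaugeField (F.P K) k (SU N)) (J : (PBond (F.P K) (k + 1) → SU N) × Z → ℝ≥0)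
    {U : Set (PBond (F.P K) (k + 1) → SU N)} {D : Set (GaugeField (F.P K) k (SU N))} (hD : IsOpen D)
    (hGF : ContinuousOn (gfOfRecord F N K k) D) (hA : ContinuousOn (effActionHT F N T (chiFixed29 F N ν ε₁) K g k) D)
    (hmeas : ∀ V₀ ∈ U, ∀ᶠ V in 𝓝[U] V₀,
      AEStronglyMeasurable (fun z => (J (V, z) : ℝ) * betaInputOfRecord F N T (chiFixed29 F N ν ε₁) K g k (Φ (V, z))) τ)
    (hconf : ∀ V₀ ∈ U, ∃ C ⊆ D, IsCompact C ∧ ∃ bound : Z → ℝ, Integrable bound τ ∧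
      ∀ᶠ V in 𝓝[U] V₀, ∀ᵐ z ∂τ, (J (V, z) : ℝ) ≤ bound z ∧ Φ (V, z) ∈ C)
    (hΦV : ∀ V₀ ∈ U, ∀ᵐ z ∂τ, ContinuousWithinAt (fun V => Φ (V, z)) U V₀)
    (hJV : ∀ V₀ ∈ U, ∀ᵐ z ∂τ, ContinuousWithinAt (fun V => (J (V, z) : ℝ)) U V₀)
    (hφ : ∀ V₀ ∈ U, ∀ b : PBond (F.P K) k, ¬ IsB0 b → ∀ᵐ z ∂τ, ContinuousWithinAt (fun V => fluctDevOfRecord F N ν K k (Φ (V, z)) b) U V₀)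
    (hnull : ∀ V₀ ∈ U, ∀ b : PBond (F.P K) k, ¬ IsB0 b → τ {z | fluctDevOfRecord F N ν K k (Φ (V₀, z)) b = ε₁} = 0) :
    ContinuousOn (fun V => ∫ z, (J (V, z) : ℝ) * betaInputOfRecord F N T (chiFixed29 F N ν ε₁) K g k (Φ (V, z)) ∂τ) U := by
  classical
  refine continuousOn_integral_of_forall_continuousWithinAt_dominated hmeas (fun V₀ hV₀ => ?_) (fun V₀ hV₀ => ?_)
  · -- the local integrable bound `bound(z)·exp(max_C A_k)`
    obtain ⟨C, hCD, hC, bound, hbi, hev⟩ := hconf V₀ hV₀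
    obtain ⟨M, hM⟩ := exists_forall_le_of_isCompact hC (hA.mono hCD)
    refine ⟨fun z => bound z * Real.exp M, hbi.mul_const _, ?_⟩
    filter_upwards [hev] with V hV
    filter_upwards [hV] with z hz
    exact norm_jacobian_mul_betaInput_chi29_le ν ε₁ T K g k hM hz.1 hz.2
  · -- a.e. continuity at `V₀`: moving thresholds (w6) + the smooth factor is continuous because `Φ(V₀,z) ∈ D`
    obtain ⟨C, hCD, _hC, bound, _hbi, hev⟩ := hconf V₀ hV₀
    have hdom : ∀ᵐ z ∂τ, Φ (V₀, z) ∈ D := by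
      filter_upwards [hev.self_of_nhdsWithin hV₀] with z hz using hCD hz.2
    have hg : ∀ᵐ z ∂τ, ContinuousWithinAt (fun V => (J (V, z) : ℝ) *
        Real.exp (-(1 / (g k) ^ 2) * gfOfRecord F N K k (Φ (V, z)) + effActionHT F N T (chiFixed29 F N ν ε₁) K g k (Φ (V, z)))) U V₀ := by
      filter_upwards [hΦV V₀ hV₀, hJV V₀ hV₀, hdom] with z hΦz hJz hz
      exact continuousWithinAt_smoothFactor_comp hD hΦz hz hJz hGF hA _
    have key := ae_continuousWithinAt_cutoff_mul (τ := τ) (Set.toFinite {b : PBond (F.P K) k | ¬ IsB0 b}) (U := U) (x₀ := V₀)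
      (φ := fun b V z => fluctDevOfRecord F N ν K k (Φ (V, z)) b) (c := fun _ => ε₁)
      (g := fun V z => (J (V, z) : ℝ) *
        Real.exp (-(1 / (g k) ^ 2) * gfOfRecord F N K k (Φ (V, z)) + effActionHT F N T (chiFixed29 F N ν ε₁) K g k (Φ (V, z))))
      (fun b hb => hφ V₀ hV₀ b hb) (fun b hb => hnull V₀ hV₀ b hb) hg
    filter_upwards [key] with z hz
    -- the fibre integrand IS the cut-off integrand (w6's identity), pointwise in `V`
    exact hz.congr
      (fun V _ => by
        rw [jacobian_mul_betaInputOfRecord_chiFixed29_eq_cutoff_mul ν ε₁ T K g k Φ (fun p => (J p : ℝ)) V z]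
        congr!)
      (by
        rw [jacobian_mul_betaInputOfRecord_chiFixed29_eq_cutoff_mul ν ε₁ T K g k Φ (fun p => (J p : ℝ)) V₀ z]
        congr!)

end Hgc

/-! ## §3 THE STEP `k → k+1` at the β-transport of record `TcanOfRecord` (= `TβOfRecord₁₃`), `D = domAlt_k`, `U = domAlt_{k+1}` -/

section Step

variable {F : T4Family} {N : ℕ} [NeZero N]
variable {Z : Type*} [TopologicalSpace Z] [MeasurableSpace Z]

/-- **★★★ THE (F1) INDUCTION STEP, CLOSED FORM.**  Fix numerics `ν`, a threshold `0 < ε₁`, a torus `K`, a history `g`, a step `k < K`; let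
`ρ_k = betaInputOfRecord (TcanOfRecord) (chiFixed29 ν ε₁) K g k` (integrable: (I19) `hint`).  RECURSIVE INPUT: `A_k` continuous on `domAlt_k` (`hA`).  STEP-`k` CHART (all
DISPLAYED): dag-n09-w6 g2's sockets `(Z, τ, Φ, J, S; hΦ hJ havgΦ hmap)` over `domAlt_{k+1}` on `S ⊇ {ρ_k ≠ 0}`, `τ` open-positive; FILE 1's base point (`Φ(V, z₀ V) = V^{(k)}(V)`,
`Φ(V,·)` continuous there, `J(V,·) > 0` nearby); and the A-FREE regularity of §2 with confinement in `domAlt_k` (`hmeas hconf hΦV hJV hφ hnull`), `GF_k` continuous on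
`domAlt_k` (`hGF`), [B11] solvability on the domain (`hsolν`).  CONCLUSION, the three faces of the step: `hreg_k : domAlt_{k+1} ⊆ regSetOfRecord K k ρ_k` (w6's
`domAlt_subset_regSetOfRecord_of_fibredChart` at the derived `hgc_k`) ∧ (F3)_k `∀ V ∈ domAlt_{k+1}, 0 < TcanOfRecord K k ρ_k V` (FILE 1) ∧ `A_{k+1}` continuous on
`domAlt_{k+1}` (FILE 1 §4).  Nothing of Bałaban's asserted. [cite: Balaban1987RG1, p.259, (0.19) p.255, (2.9) p.266 and (2.10) p.267] -/
theorem hreg_pos_contA_of_chartRegularity (ν : Stage7Numerics) {ε₁ : ℝ} (hε : 0 < ε₁) (K : ℕ) (g : ℕ → ℝ) {k : ℕ} (hk : k < K)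
    (hsolν : ∀ W ∈ domAltOfRecord F N ν K (k + 1), UkExists F N K (k + 1) ν.εreg W)
    (hint : Integrable (betaInputOfRecord F N (TcanOfRecord F N) (chiFixed29 F N ν ε₁) K g k) (fieldMeasure (F.P K) k (SU N)))
    (hGF : ContinuousOn (gfOfRecord F N K k) (domAltOfRecord F N ν K k))
    (hA : ContinuousOn (effActionHT F N (TcanOfRecord F N) (chiFixed29 F N ν ε₁) K g k) (domAltOfRecord F N ν K k))
    (τ : Measure Z) [SFinite τ] [τ.IsOpenPosMeasure] (S : Set (GaugeField (F.P K) k (SU N)))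
    (hS : ∀ x, betaInputOfRecord F N (TcanOfRecord F N) (chiFixed29 F N ν ε₁) K g k x ≠ 0 → x ∈ S)
    (Φ : (PBond (F.P K) (k + 1) → SU N) × Z → GaugeField (F.P K) k (SU N)) (J : (PBond (F.P K) (k + 1) → SU N) × Z → ℝ≥0)
    (hΦ : Measurable Φ) (hJ : Measurable J) (havgΦ : ∀ V ∈ domAltOfRecord F N ν K (k + 1), ∀ z, (avOfRecord F N K k).avg (Φ (V, z)) = V)
    (hmap : (fieldMeasure (F.P K) k (SU N)).restrict ((avOfRecord F N K k).avg ⁻¹' domAltOfRecord F N ν K (k + 1) ∩ S)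
      = ((((piHaar (F.P K) (k + 1) (SU N)).restrict (domAltOfRecord F N ν K (k + 1))).prod τ).withDensity (fun p => (J p : ℝ≥0∞))).map Φ)
    (hmeas : ∀ V₀ ∈ domAltOfRecord F N ν K (k + 1), ∀ᶠ V in 𝓝[domAltOfRecord F N ν K (k + 1)] V₀,
      AEStronglyMeasurable (fun z => (J (V, z) : ℝ) * betaInputOfRecord F N (TcanOfRecord F N) (chiFixed29 F N ν ε₁) K g k (Φ (V, z))) τ)
    (hconf : ∀ V₀ ∈ domAltOfRecord F N ν K (k + 1), ∃ C ⊆ domAltOfRecord F N ν K k, IsCompact C ∧ ∃ bound : Z → ℝ, Integrable bound τ ∧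
      ∀ᶠ V in 𝓝[domAltOfRecord F N ν K (k + 1)] V₀, ∀ᵐ z ∂τ, (J (V, z) : ℝ) ≤ bound z ∧ Φ (V, z) ∈ C)
    (hΦV : ∀ V₀ ∈ domAltOfRecord F N ν K (k + 1), ∀ᵐ z ∂τ, ContinuousWithinAt (fun V => Φ (V, z)) (domAltOfRecord F N ν K (k + 1)) V₀)
    (hJV : ∀ V₀ ∈ domAltOfRecord F N ν K (k + 1), ∀ᵐ z ∂τ, ContinuousWithinAt (fun V => (J (V, z) : ℝ)) (domAltOfRecord F N ν K (k + 1)) V₀)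
    (hφ : ∀ V₀ ∈ domAltOfRecord F N ν K (k + 1), ∀ b : PBond (F.P K) k, ¬ IsB0 b →
      ∀ᵐ z ∂τ, ContinuousWithinAt (fun V => fluctDevOfRecord F N ν K k (Φ (V, z)) b) (domAltOfRecord F N ν K (k + 1)) V₀)
    (hnull : ∀ V₀ ∈ domAltOfRecord F N ν K (k + 1), ∀ b : PBond (F.P K) k, ¬ IsB0 b → τ {z | fluctDevOfRecord F N ν K k (Φ (V₀, z)) b = ε₁} = 0)
    (z₀ : (PBond (F.P K) (k + 1) → SU N) → Z) (hz₀ : ∀ V ∈ domAltOfRecord F N ν K (k + 1), Φ (V, z₀ V) = critCfgOfRecord F N ν K k V)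
    (hΦc : ∀ V ∈ domAltOfRecord F N ν K (k + 1), ContinuousAt (fun z => Φ (V, z)) (z₀ V))
    (hJpos : ∀ V ∈ domAltOfRecord F N ν K (k + 1), ∀ᶠ z in 𝓝 (z₀ V), 0 < J (V, z)) :
    domAltOfRecord F N ν K (k + 1) ⊆ regSetOfRecord F N K k (betaInputOfRecord F N (TcanOfRecord F N) (chiFixed29 F N ν ε₁) K g k) ∧
    (∀ V ∈ domAltOfRecord F N ν K (k + 1), 0 < TcanOfRecord F N K k (betaInputOfRecord F N (TcanOfRecord F N) (chiFixed29 F N ν ε₁) K g k) V) ∧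
    ContinuousOn (effActionHT F N (TcanOfRecord F N) (chiFixed29 F N ν ε₁) K g (k + 1)) (domAltOfRecord F N ν K (k + 1)) := by
  -- `hgc_k` from §2 (confinement in the open set `domAlt_k`)
  have hgc := continuousOn_fibreIntegral_betaInput_chi29_of_chartRegularity ν ε₁ (TcanOfRecord F N) K g k τ Φ J
    (isOpen_domAltOfRecord ν K k) hGF hA hmeas hconf hΦV hJV hφ hnull
  -- per-`V` integrability from the same local bound
  have hintV : ∀ V ∈ domAltOfRecord F N ν K (k + 1),
      Integrable (fun z => (J (V, z) : ℝ) * betaInputOfRecord F N (TcanOfRecord F N) (chiFixed29 F N ν ε₁) K g k (Φ (V, z))) τ := by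
    intro V hV
    obtain ⟨C, hCD, hC, bound, hbi, hev⟩ := hconf V hV
    obtain ⟨M, hM⟩ := exists_forall_le_of_isCompact hC (hA.mono hCD)
    exact integrable_fibreIntegrand_betaInput_chi29_of_confined ν ε₁ _ K g k ((hmeas V hV).self_of_nhdsWithin hV) hM hbi
      (hev.self_of_nhdsWithin hV)
  have hreg := domAlt_subset_regSetOfRecord_of_fibredChart ν hk hint hS hΦ hJ havgΦ hmap hgc
  have hpos : ∀ V ∈ domAltOfRecord F N ν K (k + 1),
      0 < TcanOfRecord F N K k (betaInputOfRecord F N (TcanOfRecord F N) (chiFixed29 F N ν ε₁) K g k) V :=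
    TcanOfRecord_pos_on_of_fibredChart_of_eventually hk hint (betaInput_chi29_nonneg ν ε₁ _ K g k)
      (isOpen_domAltOfRecord ν K (k + 1)) hS hΦ hJ havgΦ hmap hgc hintV z₀ fun V hV =>
        eventually_jacobian_mul_comp_pos (hJpos V hV)
          (eventually_betaInput_chi29_chart_pos ν hε _ K g (hsolν V hV) (havgΦ V hV) (hΦc V hV) (hz₀ V hV))
  exact ⟨hreg, hpos, continuousOn_effActionHT_succ_of_subset_regSetOfRecord_of_pos _ K g k hreg hpos⟩

/-- **★★ THE INDUCTION STEP `k → k+1` ALONE**: `ContinuousOn A_k domAlt_k →` [step-`k` chart over `domAlt_{k+1}` through the critical configuration, A-free regularity, `GF_k`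
continuous on `domAlt_k`, `hsolν`, `hint`] `→ ContinuousOn A_{k+1} domAlt_{k+1}` — the form in which the (F1) tower over `k` is an honest induction (base: §4).
[cite: Balaban1987RG1, (0.19) p.255, p.259 and (2.10) p.267] -/
theorem continuousOn_effActionHT_succ_of_chartRegularity (ν : Stage7Numerics) {ε₁ : ℝ} (hε : 0 < ε₁) (K : ℕ) (g : ℕ → ℝ) {k : ℕ} (hk : k < K)
    (hsolν : ∀ W ∈ domAltOfRecord F N ν K (k + 1), UkExists F N K (k + 1) ν.εreg W)
    (hint : Integrable (betaInputOfRecord F N (TcanOfRecord F N) (chiFixed29 F N ν ε₁) K g k) (fieldMeasure (F.P K) k (SU N)))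
    (hGF : ContinuousOn (gfOfRecord F N K k) (domAltOfRecord F N ν K k))
    (hA : ContinuousOn (effActionHT F N (TcanOfRecord F N) (chiFixed29 F N ν ε₁) K g k) (domAltOfRecord F N ν K k))
    (τ : Measure Z) [SFinite τ] [τ.IsOpenPosMeasure] (S : Set (GaugeField (F.P K) k (SU N)))
    (hS : ∀ x, betaInputOfRecord F N (TcanOfRecord F N) (chiFixed29 F N ν ε₁) K g k x ≠ 0 → x ∈ S)
    (Φ : (PBond (F.P K) (k + 1) → SU N) × Z → GaugeField (F.P K) k (SU N)) (J : (PBond (F.P K) (k + 1) → SU N) × Z → ℝ≥0)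
    (hΦ : Measurable Φ) (hJ : Measurable J) (havgΦ : ∀ V ∈ domAltOfRecord F N ν K (k + 1), ∀ z, (avOfRecord F N K k).avg (Φ (V, z)) = V)
    (hmap : (fieldMeasure (F.P K) k (SU N)).restrict ((avOfRecord F N K k).avg ⁻¹' domAltOfRecord F N ν K (k + 1) ∩ S)
      = ((((piHaar (F.P K) (k + 1) (SU N)).restrict (domAltOfRecord F N ν K (k + 1))).prod τ).withDensity (fun p => (J p : ℝ≥0∞))).map Φ)
    (hmeas : ∀ V₀ ∈ domAltOfRecord F N ν K (k + 1), ∀ᶠ V in 𝓝[domAltOfRecord F N ν K (k + 1)] V₀,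
      AEStronglyMeasurable (fun z => (J (V, z) : ℝ) * betaInputOfRecord F N (TcanOfRecord F N) (chiFixed29 F N ν ε₁) K g k (Φ (V, z))) τ)
    (hconf : ∀ V₀ ∈ domAltOfRecord F N ν K (k + 1), ∃ C ⊆ domAltOfRecord F N ν K k, IsCompact C ∧ ∃ bound : Z → ℝ, Integrable bound τ ∧
      ∀ᶠ V in 𝓝[domAltOfRecord F N ν K (k + 1)] V₀, ∀ᵐ z ∂τ, (J (V, z) : ℝ) ≤ bound z ∧ Φ (V, z) ∈ C)
    (hΦV : ∀ V₀ ∈ domAltOfRecord F N ν K (k + 1), ∀ᵐ z ∂τ, ContinuousWithinAt (fun V => Φ (V, z)) (domAltOfRecord F N ν K (k + 1)) V₀)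
    (hJV : ∀ V₀ ∈ domAltOfRecord F N ν K (k + 1), ∀ᵐ z ∂τ, ContinuousWithinAt (fun V => (J (V, z) : ℝ)) (domAltOfRecord F N ν K (k + 1)) V₀)
    (hφ : ∀ V₀ ∈ domAltOfRecord F N ν K (k + 1), ∀ b : PBond (F.P K) k, ¬ IsB0 b →
      ∀ᵐ z ∂τ, ContinuousWithinAt (fun V => fluctDevOfRecord F N ν K k (Φ (V, z)) b) (domAltOfRecord F N ν K (k + 1)) V₀)
    (hnull : ∀ V₀ ∈ domAltOfRecord F N ν K (k + 1), ∀ b : PBond (F.P K) k, ¬ IsB0 b → τ {z | fluctDevOfRecord F N ν K k (Φ (V₀, z)) b = ε₁} = 0)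
    (z₀ : (PBond (F.P K) (k + 1) → SU N) → Z) (hz₀ : ∀ V ∈ domAltOfRecord F N ν K (k + 1), Φ (V, z₀ V) = critCfgOfRecord F N ν K k V)
    (hΦc : ∀ V ∈ domAltOfRecord F N ν K (k + 1), ContinuousAt (fun z => Φ (V, z)) (z₀ V))
    (hJpos : ∀ V ∈ domAltOfRecord F N ν K (k + 1), ∀ᶠ z in 𝓝 (z₀ V), 0 < J (V, z)) :
    ContinuousOn (effActionHT F N (TcanOfRecord F N) (chiFixed29 F N ν ε₁) K g (k + 1)) (domAltOfRecord F N ν K (k + 1)) :=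
  (hreg_pos_contA_of_chartRegularity ν hε K g hk hsolν hint hGF hA τ S hS Φ J hΦ hJ havgΦ hmap hmeas hconf hΦV hJV hφ hnull z₀ hz₀ hΦc hJpos).2.2

end Step

/-! ## §4 THE BASE: `A_0 = −(1∕g_0²)A` is continuous everywhere -/

section Base

variable {F : T4Family} {N : ℕ} [NeZero N]

/-- The Wilson action `A^w(U) = Σ_p w·[1 − Re tr U(∂p)]` is continuous on `SU(N)`-valued configurations (finite sum; `Re tr` and the plaquette holonomies are continuous).
[cite: Balaban1987RG1, (0.2) p.252 (bookkeeping)] -/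
theorem continuous_wilsonAction_SU (P : Params) (j : ℕ) (w : ℝ) : Continuous (fun U : GaugeField P j (SU N) => Balaban1983to89.wilsonAction w U) := by
  have hre : Continuous (GaugeGroup.reTr : SU N → ℝ) :=
    UnitaryModel.continuous_nReTr.comp (Literature.MathematicalPhysics.QuantumLattice.continuous_fundamentalRep (Fin N))
  unfold Balaban1983to89.wilsonAction
  refine continuous_finsetSum _ fun p _ => continuous_const.mul (continuous_const.sub ?_)
  exact hre.comp (continuous_plaqHol_SU p)

/-- **★ THE BASE OF THE (F1) INDUCTION**: `A_0 = −(1∕g_0²)·A` ((0.17)) is continuous on the whole step-`0` configuration space, for every transport and χ.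
[cite: Balaban1987RG1, (0.17) p.255] -/
theorem continuous_effActionHT_zero (T : Transport F N) (χ : (K : ℕ) → (ℕ → ℝ) → (k : ℕ) → Density (F.P K) k (SU N)) (K : ℕ) (g : ℕ → ℝ) :
    Continuous (effActionHT F N T χ K g 0) := by
  rw [effActionHT_zero]
  show Continuous fun U : GaugeField (F.P K) 0 (SU N) => wilsonTerm (g 0) 1 U
  simp only [wilsonTerm_apply]
  exact continuous_const.mul (continuous_wilsonAction_SU (F.P K) 0 1)

/-- … in particular on `domAlt_0` (the `k = 0` instance of the recursive input `hA`). [cite: Balaban1987RG1, (0.17) p.255 and p.259] -/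
theorem continuousOn_effActionHT_zero (T : Transport F N) (χ : (K : ℕ) → (ℕ → ℝ) → (k : ℕ) → Density (F.P K) k (SU N)) (K : ℕ) (g : ℕ → ℝ)
    (D : Set (GaugeField (F.P K) 0 (SU N))) : ContinuousOn (effActionHT F N T χ K g 0) D :=
  (continuous_effActionHT_zero T χ K g).continuousOn

end Base

end Summit.QuantumFields.YangMills.BalabanUVNodes.N09FibreIntegralContinuousOfChartRegularity

end
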